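import Summits.QuantumFields.BalabanUV.T4Continuum.Support.NE7K1LinLineLaplacian
import Summits.QuantumFields.BalabanUV.T4Continuum.Support.NE7K1LinBoxCov237
import Summits.QuantumFields.BalabanUV.T4Continuum.Support.NE7K1LinRegionLine

/-!
# NE7K1LinBoxScales — row NE7 (node U5), candidate route HOM, path H1L, cell K1-lin(s): card §3y STEP 7, PART 2 —
# THE LINE's OPERATORS OF ALL SCALES ON THE FINE NEUMANN BOX (B4 (2.34) for the line, objects), THEIR IDENTIFICATION WITH
# RESCALED BOX LINES `s_j²·boxLine(L^j, a_j, s)`, THE BLOCK-ROW FORM OF (2.35) AND THE ONE-STEP DECAY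

Lineage `b2b-balaban-t4-ne7-p2` (CRUX PROVER NE7 #2), generation 79; file 95.  b04's `B4Thm110ZeroBox` §4 ∕ §7 with `boxOpR ↦ boxLine`
(`NE7K1LinBoxCovEnergy.boxLine`, the two-cutoff line `T^Π(s) + a·Q_n^*Q_n` of a Neumann box); scales, casts, block matrices
(`Nf`, `Mp`, `Mj`, `bj`, `sc`, `ej`, `QkM`, `QksM`, `Pmat`, `αj`) are b04's BY NAME.  For the fine box `X = boxDom (L^k·M)` (η = L^{−k}):

* §1 **`HfineL ℓ k M s = (L^k)²·boxLap`** (the line Laplacian of the fine box in `η`-units, file 94) and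
  **`fineOpL ℓ k M j a s = HfineL + α_j·P_{b_j}`** — the scale-`j` operator `G_j^η(□; s)^{−1}` of (2.34) FOR THE LINE;
  **`fineOpL_top`**: `fineOpL_k = boxLine(L^k, M, a_k, s)` (`a_k = B1.aSeq a L k`, file 94's `boxLine_eq_boxLap`);
  **`fineOpL_eq_submatrix`**: `fineOpL_j = s_j²·boxLine(L^j, Mj, a_j, s)` reindexed (`j + 1 ≤ k`) — THE SCALE-`j` OPERATOR OF THE LINE
  IS A RESCALED BOX LINE (file 94's `boxLap_apply_congr`: the line Laplacian is mesh-free).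
* §2 `GfineL := fineOpL⁻¹`, `GfineL_eq_submatrix ∕ _apply` (`= s_j^{−2}·G^Π(s; L^j, a_j)` reindexed), `fineOpL_mul_GfineL`, `fineOpL_isUnit`,
  `GfineL_isSymm`, and **`GfineL_blockRow_bound`** — (2.35), first quantity, for every scale: `|Σ_{x′ : blk x′ = y}𝒢_j(x, x′)| ≤
  s_j^{−2}·C_□·e^{−κ′|blk x − y|}` with `(κ′, C_□) = (κ_line∕(d+1), Cbox)(d, a₋(1−L^{−2}), a₊)` ONLY — every `s ∈ [0,1]`, `k`, `j`, box
  (file 81's `boxLine_blockRow_bound` = file 77's (2.35) in real form).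
* §3 **`boxLine_L_inv_decay`** — the decay of the ONE-STEP box line's inverse at mesh `L` (the base of the induction over `j`):
  `|(boxLine(L, M′, a, s))⁻¹(x, y)| ≤ (2L^{d+1}∕min(2, a₋))·e^{−(lineRate∕L)|x − y|_∞}` for every `s ∈ [0,1]`, `a ∈ [a₋,a₊]`, box `M′`
  (`NE7K1LinSchurLineU1.twoCutoff_inv_decay` at mesh `L` with file 87's admissible rate `lineRate(d, L, a₋, a₊)`).

HONEST FRAMING: [folklore]; bookkeeping over files 63 ∕ 77 ∕ 80 ∕ 81 ∕ 87 ∕ 94 and b04; A = 0; nothing of Bałaban's asserted; no `sorry`.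
Census only (STEP 7, part 2); NE7 NOT PRINTED ∕ NOT PROVED; spine 0∕9; FIXED FINITE T⁴, rung (B)+1; NOT infinite volume, NOT mass gap,
NOT Clay.  HONEST DEPENDENCY: continuum YM on T⁴ ⇐ BetaPertH ∧ nine spine estimates (0/9 proved); BetaPertH ⇐ (D1) ∧ (D4) ∧ CAP+tail;
G-an2-4 gates asym, D1 and NE2/3/4.
-/

noncomputable section

open Finset Matrix

namespace Summit.QuantumFields.BalabanUV.T4Continuum.NE7K1LinBoxScales

open Literature.MathematicalPhysics.QuantumFieldTheory.Balaban1983to89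
open Literature.MathematicalPhysics.QuantumFieldTheory.Balaban1983to89.B4Reflection242
open Literature.MathematicalPhysics.QuantumFieldTheory.Balaban1983to89.B4Lower18
open Literature.MathematicalPhysics.QuantumFieldTheory.Balaban1983to89.B4ContourShift (supNorm supNorm_nonneg)
open Literature.MathematicalPhysics.QuantumFieldTheory.Balaban1983to89.B4BoxCov237
open Literature.MathematicalPhysics.QuantumFieldTheory.Balaban1983to89.B4Thm110ZeroBox
open NE7K1LinSchurLineU1 NE7K1LinSchurFoldBox NE7K1LinBoxCovEnergy NE7K1LinLineLaplacian NE7K1LinBoxCov237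
open NE7K1LinRegionLine (lineRate lineRate_pos lineRate_le_one lineRate_small)
open NE7K1LinStripClassLine (kappaLine kappaLine_pos)

variable {d : ℕ}

/-! ### §1 The line's operators of all scales on the fine box -/

section Scales

variable {ℓ k j : ℕ} {M : Fin (d + 1) → ℕ} {a s : ℝ}

/-- **`H = η^{−2}·(line Laplacian of □)`** in values form on the fine box: `(L^k)²·boxLap(L, L^k, M, s)` (file 94; no averaging term).
[folklore] -/
def HfineL (ℓ k : ℕ) (M : Fin (d + 1) → ℕ) (s : ℝ) : Matrix ↥(boxDom (Nf ℓ k M)) ↥(boxDom (Nf ℓ k M)) ℝ :=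
  ((((ℓ + 1) ^ k : ℕ) : ℝ) ^ 2) • boxLap (ℓ + 1) (Nat.one_le_pow k (ℓ + 1) (Nat.succ_pos ℓ)) M s

/-- **THE SCALE-`j` OPERATOR OF (2.34) FOR THE LINE**: `G_j^η(□; s)^{−1} = H + α_jP_{b_j}`, `α_j = a_j(L^jη)^{−2}`.
[cite: Balaban1983RegularityDecay, p. 582 (2.34), for the two-cutoff line] [folklore] -/
def fineOpL (ℓ k : ℕ) (M : Fin (d + 1) → ℕ) (j : ℕ) (a s : ℝ) : Matrix ↥(boxDom (Nf ℓ k M)) ↥(boxDom (Nf ℓ k M)) ℝ :=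
  HfineL ℓ k M s + αj a ℓ k j • Pmat (bj ℓ j) (Nf ℓ k M)

/-- `H` is symmetric. [folklore] -/
theorem HfineL_isSymm (ℓ k : ℕ) (M : Fin (d + 1) → ℕ) (s : ℝ) : (HfineL ℓ k M s).IsSymm :=
  (boxLap_isSymm (ℓ + 1) (Nat.one_le_pow k (ℓ + 1) (Nat.succ_pos ℓ)) s).smul _

/-- the block projection is symmetric. [folklore] -/
theorem Pmat_isSymm (b : ℕ) (N : Fin (d + 1) → ℕ) : (Pmat b N).IsSymm := by
  ext x y
  simp only [Pmat, Matrix.transpose_apply, Matrix.of_apply, eq_comm]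

/-- the scale-`j` operator is symmetric. [folklore] -/
theorem fineOpL_isSymm (ℓ k : ℕ) (M : Fin (d + 1) → ℕ) (j : ℕ) (a s : ℝ) : (fineOpL ℓ k M j a s).IsSymm :=
  (HfineL_isSymm ℓ k M s).add ((Pmat_isSymm (bj ℓ j) (Nf ℓ k M)).smul _)

/-- **THE TOP SCALE IS THE BOX LINE**: `fineOpL_k = boxLine(L^k, M, a_k, s)` — the two-cutoff line `T^Π(s) + a_kQ_k^*Q_k` of the
Neumann box at mesh `η = L^{−k}` in values form (file 94's `boxLine_eq_boxLap`). [folklore] -/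
theorem fineOpL_top (ℓ k : ℕ) (M : Fin (d + 1) → ℕ) (a s : ℝ) :
    fineOpL ℓ k M k a s = boxLine (ℓ + 1) (Nat.one_le_pow k (ℓ + 1) (Nat.succ_pos ℓ)) M (B1.aSeq a ((ℓ : ℝ) + 1) k) s := by
  rw [fineOpL, HfineL, boxLine_eq_boxLap, αj, sc_self, one_pow, mul_one]

/-- the fine box of the level-`k` problem and that of the scale-`j` presentation coincide as sets:
`boxDom (L^k·L·M) = boxDom (b_j·L·Mj)` (`j + 1 ≤ k`). [folklore] -/
theorem fineRegion_eq (hj : j + 1 ≤ k) (M : Fin (d + 1) → ℕ) :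
    (boxDom fun i => (ℓ + 1) ^ k * (ℓ + 1) * M i) = (boxDom fun i => bj ℓ j * (ℓ + 1) * Mj ℓ k M j i) := by
  congr 1
  funext i
  have h := congrFun (Nf_eq_bj_Mj (ℓ := ℓ) hj M) i
  simp only [Nf] at h
  rw [Nat.mul_right_comm (bj ℓ j), h, Nat.mul_right_comm]

/-- **IDENTIFICATION OF THE SCALE-`j` OPERATOR**: `fineOpL_j = s_j²·boxLine(L^j, Mj, a_j, s)` reindexed to the fine box (`s_j = L^{k−j}`)
— THE LINE ANALOGUE OF b04's `fineOp_eq_submatrix`: the line Laplacian is mesh-free (file 94), so `(L^k)²·boxLap(L^k, M) =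
s_j²·b_j²·boxLap(b_j, Mj)`, and `α_j·P_{b_j} = s_j²·a_j·P_{b_j}`. [folklore] -/
theorem fineOpL_eq_submatrix (hj : j + 1 ≤ k) (M : Fin (d + 1) → ℕ) (a s : ℝ) :
    fineOpL ℓ k M j a s
      = sc ℓ k j ^ 2 • (boxLine (ℓ + 1) (bj_pos ℓ j) (Mj ℓ k M j) (B1.aSeq a ((ℓ : ℝ) + 1) j) s).submatrix
          (ej ℓ k M j hj).symm (ej ℓ k M j hj).symm := by
  ext x y
  rw [fineOpL, HfineL, boxLine_eq_boxLap]
  simp only [Matrix.add_apply, Matrix.smul_apply, Matrix.submatrix_apply, smul_eq_mul]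
  have hL : boxLap (ℓ + 1) (Nat.one_le_pow k (ℓ + 1) (Nat.succ_pos ℓ)) M s x y
      = boxLap (ℓ + 1) (bj_pos ℓ j) (Mj ℓ k M j) s ((ej ℓ k M j hj).symm x) ((ej ℓ k M j hj).symm y) :=
    boxLap_apply_congr (ℓ + 1) (Nat.one_le_pow k (ℓ + 1) (Nat.succ_pos ℓ)) (bj_pos ℓ j) (fineRegion_eq hj M) s x y _ _ rfl rfl
  have hP : Pmat (bj ℓ j) (Nf ℓ k M) x y
      = Pmat (bj ℓ j) (fun i => bj ℓ j * Mj ℓ k M j i) ((ej ℓ k M j hj).symm x) ((ej ℓ k M j hj).symm y) := rfl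
  have hn : ((((ℓ + 1) ^ k : ℕ) : ℝ)) ^ 2 = sc ℓ k j ^ 2 * ((bj ℓ j : ℝ)) ^ 2 := by
    rw [← mul_pow, sc_mul_bj (by omega)]
    push_cast
    ring
  rw [hL, hP, hn, αj]
  ring

end Scales

/-! ### §2 The propagators of all scales and the block-row form of (2.35) -/

section Green

variable {ℓ k j : ℕ} {M : Fin (d + 1) → ℕ} {a s : ℝ}

/-- the propagator of scale `j` for the line: `𝒢_j(s) := fineOpL_j⁻¹ = G_j^η(□; s)` of (2.34).
[cite: Balaban1983RegularityDecay, p. 582 (2.34), for the two-cutoff line] [folklore] -/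
def GfineL (ℓ k : ℕ) (M : Fin (d + 1) → ℕ) (j : ℕ) (a s : ℝ) : Matrix ↥(boxDom (Nf ℓ k M)) ↥(boxDom (Nf ℓ k M)) ℝ :=
  (fineOpL ℓ k M j a s)⁻¹

/-- **`𝒢_j(s) = s_j^{−2}·G^Π(s; L^j, Mj, a_j)` reindexed**, `G^Π = boxLine⁻¹` the box line's propagator (so file 81's (2.35) applies).
[folklore] -/
theorem GfineL_eq_submatrix (hℓ : 1 ≤ ℓ) (hj1 : 1 ≤ j) (hj : j + 1 ≤ k) (hM : ∀ i, 1 ≤ M i) (ha : 0 < a) (hs0 : 0 ≤ s)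
    (hs1 : s ≤ 1) :
    GfineL ℓ k M j a s
      = (sc ℓ k j ^ 2)⁻¹ • ((boxLine (ℓ + 1) (bj_pos ℓ j) (Mj ℓ k M j) (B1.aSeq a ((ℓ : ℝ) + 1) j) s)⁻¹).submatrix
          (ej ℓ k M j hj).symm (ej ℓ k M j hj).symm := by
  rw [GfineL, fineOpL_eq_submatrix hj]
  exact inv_smul_submatrix (boxLine_mul_inv (ℓ + 1) (bj_pos ℓ j) (Mj_pos hM) (B1.aSeq_pos ha (one_lt_L_real hℓ) hj1) hs0 hs1)
    (pow_pos (sc_pos ℓ k j) 2).ne' _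

/-- entries of `𝒢_j(s)`. [folklore] -/
theorem GfineL_apply (hℓ : 1 ≤ ℓ) (hj1 : 1 ≤ j) (hj : j + 1 ≤ k) (hM : ∀ i, 1 ≤ M i) (ha : 0 < a) (hs0 : 0 ≤ s) (hs1 : s ≤ 1)
    (x y : ↥(boxDom (Nf ℓ k M))) :
    GfineL ℓ k M j a s x y
      = (sc ℓ k j ^ 2)⁻¹ * (boxLine (ℓ + 1) (bj_pos ℓ j) (Mj ℓ k M j) (B1.aSeq a ((ℓ : ℝ) + 1) j) s)⁻¹
          ((ej ℓ k M j hj).symm x) ((ej ℓ k M j hj).symm y) := by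
  rw [GfineL_eq_submatrix hℓ hj1 hj hM ha hs0 hs1, Matrix.smul_apply, Matrix.submatrix_apply, smul_eq_mul]

/-- `fineOpL_j·𝒢_j = 1` (genuine inverse; `1 ≤ j`, `j + 1 ≤ k`). [folklore] -/
theorem fineOpL_mul_GfineL (hℓ : 1 ≤ ℓ) (hj1 : 1 ≤ j) (hj : j + 1 ≤ k) (hM : ∀ i, 1 ≤ M i) (ha : 0 < a) (hs0 : 0 ≤ s)
    (hs1 : s ≤ 1) : fineOpL ℓ k M j a s * GfineL ℓ k M j a s = 1 := by
  rw [GfineL_eq_submatrix hℓ hj1 hj hM ha hs0 hs1, fineOpL_eq_submatrix hj, Matrix.smul_mul, Matrix.mul_smul, smul_smul,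
    Matrix.submatrix_mul_equiv,
    boxLine_mul_inv (ℓ + 1) (bj_pos ℓ j) (Mj_pos hM) (B1.aSeq_pos ha (one_lt_L_real hℓ) hj1) hs0 hs1,
    Matrix.submatrix_one_equiv, mul_inv_cancel₀ (pow_pos (sc_pos ℓ k j) 2).ne', one_smul]

/-- the top propagator is the box line's inverse: `𝒢_k(s) = boxLine(L^k, M, a_k, s)⁻¹`. [folklore] -/
theorem GfineL_top (ℓ k : ℕ) (M : Fin (d + 1) → ℕ) (a s : ℝ) :
    GfineL ℓ k M k a s = (boxLine (ℓ + 1) (Nat.one_le_pow k (ℓ + 1) (Nat.succ_pos ℓ)) M (B1.aSeq a ((ℓ : ℝ) + 1) k) s)⁻¹ := by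
  rw [GfineL, fineOpL_top]

/-- `fineOpL_k·𝒢_k = 1` at the top scale (`k ≥ 1`). [folklore] -/
theorem fineOpL_mul_GfineL_top (hℓ : 1 ≤ ℓ) (hk : 1 ≤ k) (hM : ∀ i, 1 ≤ M i) (ha : 0 < a) (hs0 : 0 ≤ s) (hs1 : s ≤ 1) :
    fineOpL ℓ k M k a s * GfineL ℓ k M k a s = 1 := by
  rw [GfineL_top, fineOpL_top]
  exact boxLine_mul_inv (ℓ + 1) (Nat.one_le_pow k (ℓ + 1) (Nat.succ_pos ℓ)) hM (B1.aSeq_pos ha (one_lt_L_real hℓ) hk) hs0 hs1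

/-- `fineOpL_j` is a unit (`1 ≤ j ≤ k`). [folklore] -/
theorem fineOpL_isUnit (hℓ : 1 ≤ ℓ) (hj1 : 1 ≤ j) (hjk : j ≤ k) (hM : ∀ i, 1 ≤ M i) (ha : 0 < a) (hs0 : 0 ≤ s) (hs1 : s ≤ 1) :
    IsUnit (fineOpL ℓ k M j a s) := by
  rcases Nat.lt_or_ge j k with hj | hj
  · exact (Matrix.isUnit_iff_isUnit_det _).mpr
      (Matrix.isUnit_det_of_right_inverse (fineOpL_mul_GfineL hℓ hj1 (by omega) hM ha hs0 hs1))
  · obtain rfl : j = k := le_antisymm hjk hj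
    exact (Matrix.isUnit_iff_isUnit_det _).mpr
      (Matrix.isUnit_det_of_right_inverse (fineOpL_mul_GfineL_top hℓ hj1 hM ha hs0 hs1))

/-- `𝒢_j(s)` is symmetric. [folklore] -/
theorem GfineL_isSymm (ℓ k : ℕ) (M : Fin (d + 1) → ℕ) (j : ℕ) (a s : ℝ) : (GfineL ℓ k M j a s).IsSymm := by
  unfold GfineL Matrix.IsSymm
  rw [Matrix.transpose_nonsing_inv, (fineOpL_isSymm ℓ k M j a s).eq]

/-- **BLOCK-ROW SUMS OF `𝒢_j(s)` DECAY** (transport of file 81's (2.35), first quantity, to the fine box, with the factor `s_j^{−2}`):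
`|Σ_{x′ : blk_{b_j} x′ = y} 𝒢_j(x, x′)| ≤ s_j^{−2}·C_□·e^{−κ′|blk_{b_j} x − y|}`, ONE pair `(κ′, C_□)` in `(d, ℓ, a₋, a₊)` for every `k`, `j`,
`s ∈ [0,1]`, `a ∈ [a₋,a₊]` and box. [cite: Balaban1983RegularityDecay, p. 582 (2.35), for the two-cutoff line] -/
theorem GfineL_blockRow_bound (d ℓ : ℕ) (hℓ : 1 ≤ ℓ) (aminus aplus : ℝ) (ha : 0 < aminus) :
    ∃ κ C : ℝ, 0 < κ ∧ 0 ≤ C ∧ ∀ (k j : ℕ), 1 ≤ j → ∀ (hj : j + 1 ≤ k), ∀ (a s : ℝ), aminus ≤ a → a ≤ aplus →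
      0 ≤ s → s ≤ 1 → ∀ (M : Fin (d + 1) → ℕ), (∀ i, 1 ≤ M i) →
        ∀ (x : ↥(boxDom (Nf ℓ k M))) (y : Fin (d + 1) → ℤ), y ∈ boxDom (Mj ℓ k M j) →
          |∑ x' : ↥(boxDom (Nf ℓ k M)), (if blk (bj ℓ j) x'.1 = y then GfineL ℓ k M j a s x x' else 0)|
            ≤ (sc ℓ k j ^ 2)⁻¹ * C * Real.exp (-(κ * supNorm (blk (bj ℓ j) x.1 - y))) := by
  set amin' : ℝ := aminus * (1 - ((((ℓ : ℝ) + 1)) ^ 2)⁻¹) with hamin'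
  have ha' : 0 < amin' := aminus'_pos hℓ ha
  refine ⟨kappaLine (d + 1) amin' aplus / (d + 1), Cbox d amin' aplus,
    div_pos (kappaLine_pos (d + 1) aplus ha') (by positivity), Cbox_nonneg d amin' aplus, ?_⟩
  intro k j hj1 hj a s h1 h2 hs0 hs1 M hM x y hy
  have ha0 : 0 < a := lt_of_lt_of_le ha h1
  obtain ⟨hw1, hw2, hapos⟩ := aSeq_window hℓ ha h1 h2 hj1
  have hs : 0 < sc ℓ k j ^ 2 := pow_pos (sc_pos ℓ k j) 2
  have hrow := NE7K1LinBoxCov237.boxLine_blockRow_bound (ℓ + 1) (bj_pos ℓ j) (Mj_pos hM) ha' hw1 hw2 hs0 hs1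
    ((ej ℓ k M j hj).symm x) ⟨y, hy⟩
  have hxv : ((ej ℓ k M j hj).symm x).1 = x.1 := rfl
  rw [hxv, Finset.sum_filter] at hrow
  have hsum : ∑ x' : ↥(boxDom (Nf ℓ k M)), (if blk (bj ℓ j) x'.1 = y then GfineL ℓ k M j a s x x' else 0)
      = (sc ℓ k j ^ 2)⁻¹ * ∑ z : ↥(boxDom (fun i => bj ℓ j * Mj ℓ k M j i)),
          (if blk (bj ℓ j) z.1 = y then
            (boxLine (ℓ + 1) (bj_pos ℓ j) (Mj ℓ k M j) (B1.aSeq a ((ℓ : ℝ) + 1) j) s)⁻¹ ((ej ℓ k M j hj).symm x) z else 0) := by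
    rw [sum_Nf_eq_sum_ej hj, Finset.mul_sum]
    refine Finset.sum_congr rfl fun z _ => ?_
    have hzv : (ej ℓ k M j hj z).1 = z.1 := rfl
    rw [hzv]
    split_ifs with hz
    · rw [GfineL_apply hℓ hj1 hj hM ha0 hs0 hs1, Equiv.symm_apply_apply]
    · rw [mul_zero]
  rw [hsum, abs_mul, abs_of_pos (inv_pos.2 hs), mul_assoc]
  exact mul_le_mul_of_nonneg_left hrow (inv_pos.2 hs).le

end Green

/-! ### §3 The one-step box line: the decay of its inverse (the base of the induction) -/

section OneStep

/-- **DECAY OF THE ONE-STEP BOX LINE's INVERSE** (mesh `L`, refinement `L`): for every window `a ∈ [a₋, a₊]` (`a₋ > 0`) there are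
`κ, C > 0` in `(d, ℓ, a₋, a₊)` with `|(boxLine(L, M′, a, s))⁻¹(x, y)| ≤ C·e^{−κ|x − y|_∞}` for EVERY `s ∈ [0,1]`, `a` in the window and
box `M′` — `NE7K1LinSchurLineU1.twoCutoff_inv_decay` at mesh `L` with the admissible rate `lineRate(d, L, a₋, a₊)` of file 87
(`κ = lineRate∕L`, `C = 2L^{d+1}∕min(2, a₋)`). [folklore] -/
theorem boxLine_L_inv_decay (d ℓ : ℕ) (amin aplus : ℝ) (ha : 0 < amin) :
    ∃ κ C : ℝ, 0 < κ ∧ 0 < C ∧ ∀ (n : ℕ) (hn : 1 ≤ n), n = ℓ + 1 → ∀ (a s : ℝ), amin ≤ a → a ≤ aplus → 0 ≤ s → s ≤ 1 →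
      ∀ (M' : Fin (d + 1) → ℕ) (x y : ↥(boxDom (fun i => n * M' i))),
        |(boxLine (ℓ + 1) hn M' a s)⁻¹ x y| ≤ C * Real.exp (-(κ * supNorm (x.1 - y.1))) := by
  have hL : 1 ≤ ℓ + 1 := by omega
  set δ : ℝ := lineRate d (ℓ + 1) amin aplus with hδ
  have hδ0 : 0 < δ := lineRate_pos d hL aplus ha
  have hδ1 : δ ≤ 1 := lineRate_le_one d (ℓ + 1) amin aplus
  have hmin : 0 < min 2 amin := lt_min (by norm_num) ha
  refine ⟨δ * (1 / (((ℓ + 1 : ℕ) : ℝ))), 2 / (min 2 amin / (((ℓ + 1 : ℕ) : ℝ)) ^ (d + 1)), by positivity, by positivity, ?_⟩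
  intro n hn hnL a s h1 h2 hs0 hs1 M' x y
  subst hnL
  have ha0 : 0 < a := lt_of_lt_of_le ha h1
  have hsmall := lineRate_small d hL ha h1 h2
  have hdec := (twoCutoff_inv_decay (L := ℓ + 1) hn (fineBox_isBlockUnion hn hL M') ha0 hδ0.le hδ1 hsmall hs0 hs1
    ((boxEquiv (ℓ + 1) (ℓ + 1) M').symm x) ((boxEquiv (ℓ + 1) (ℓ + 1) M').symm y)).2
  rw [boxLine_inv_apply]
  refine hdec.trans ?_
  have hmono : 2 / (min 2 a / (((ℓ + 1 : ℕ) : ℝ)) ^ (d + 1)) ≤ 2 / (min 2 amin / (((ℓ + 1 : ℕ) : ℝ)) ^ (d + 1)) := by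
    apply div_le_div_of_nonneg_left (by norm_num) (by positivity)
    exact div_le_div_of_nonneg_right (min_le_min le_rfl h1) (by positivity)
  have hx : ((boxEquiv (ℓ + 1) (ℓ + 1) M').symm x).1 = x.1 := rfl
  have hy : ((boxEquiv (ℓ + 1) (ℓ + 1) M').symm y).1 = y.1 := rfl
  have hdist : edistR (ℓ + 1) ((boxDom fun i => (ℓ + 1) * (ℓ + 1) * M' i).image (blk (ℓ + 1)))
      ((boxEquiv (ℓ + 1) (ℓ + 1) M').symm x) ((boxEquiv (ℓ + 1) (ℓ + 1) M').symm y) = (1 / (((ℓ + 1 : ℕ) : ℝ))) * supNorm (x.1 - y.1) := by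
    simp only [edistR, hx, hy]
  rw [hdist, ← mul_assoc]
  exact mul_le_mul_of_nonneg_right hmono (Real.exp_pos _).le

end OneStep

end Summit.QuantumFields.BalabanUV.T4Continuum.NE7K1LinBoxScales

end
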